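import Summits.ResolutionOfSingularities.ResolutionOfSingularities.Theses.DefectlessFrames

/-!
# Refutation of `DefectlessFrames.DefectlessFrames` (route DefectlessFrames, stmt-ResolutionOfSingularities-18873)

The crux quantifies over "hypersurface frames" `(y, z, f)` with `y` algebraically independent,
`k(y, z) = K` and `Ideal.span {f} = ker (aeval (y, z))`, but it does NOT require `f ≠ 0`
(equivalently: `z` algebraic over `k(y)`).  The degenerate frame `n = 0`, `z` transcendental,
`f = 0` satisfies every hypothesis, while the conclusion asks for a frame `(y', z')` with `y'`
EMPTY and `z'` integral over `k[y'] = k` generating `K` — impossible when `K/k` is transcendental.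

Witness: `k = ZMod 2`, `K = RatFunc k`, `O` = valuation ring of the `X`-adic valuation
(rank one, residue field `k`), `z = X`.  Refuter seat refuter-rreview-0817T03-1-0, 2026-08-17.
-/

set_option linter.dupNamespace false -- mandated namespace `Summit.<S>.<S>.Theorems` of this single-conjunct summit

open scoped Polynomial
open IsDedekindDomain.HeightOneSpectrum

/-- **Record of the dropped route item `DefectlessFrames`** = stmt-ResolutionOfSingularities-19085 (ledger
signature verbatim; NOT a route item): after `DefectlessFramesDefectlessFrames_refuted` below closed the item
`refuted`, route DefectlessFrames rev 3 (2026-08-17T05:08Z) replaced the decl by the repaired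
`DefectlessFramesR`, so `Theses.DefectlessFrames.DefectlessFrames` no longer exists in the route file and this
accepted refutation (plus its 4 importers) stopped elaborating. Re-created here under its original name so the
negative result keeps building (buildfix lane 2026-08-19; statement of every previously accepted declaration
in this file unchanged). -/
def _root_.Summit.ResolutionOfSingularities.ResolutionOfSingularities.Theses.DefectlessFrames.DefectlessFrames :
    Prop :=
  ∀ p : ℕ, p.Prime → ∀ (k K : Type) [Field k] [CharP k p] [PerfectField k] [Field K] [Algebra k K], (⊤ : IntermediateField k K).FG → ∀ O : ValuationSubring K, ∀ hk : (∀ c : k, algebraMap k K c ∈ O), Nonempty O.valuation.RankOne → (∀ x ∈ O, ∃ f : Polynomial k, f ≠ 0 ∧ Polynomial.aeval x f ∈ O.nonunits) → let ρ : k →+* IsLocalRing.ResidueField O := (IsLocalRing.residue O).comp ((algebraMap k K).codRestrict O hk); let axis : (m : ℕ) → (Fin m → O) → MvPolynomial (Fin (m + 1)) k → Polynomial (IsLocalRing.ResidueField O) := fun _ w g => MvPolynomial.eval₂ (Polynomial.C.comp ρ) (Fin.snoc (fun j => Polynomial.C (IsLocalRing.residue O (w j))) Polynomial.X) g; ∀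 (n : ℕ) (y : Fin n → O) (z : O) (f : MvPolynomial (Fin (n + 1)) k), AlgebraicIndependent k (fun i => (y i : K)) → IntermediateField.adjoin k (Set.range (fun i => (y i : K)) ∪ {(z : K)}) = ⊤ → Ideal.span {f} = RingHom.ker (MvPolynomial.aeval (Fin.snoc (fun i => (y i : K)) (z : K)) : MvPolynomial (Fin (n + 1)) k →ₐ[k] K) → ∃ (y' : Fin n → O) (z' : O) (f' : MvPolynomial (Fin (n + 1)) k), AlgebraicIndependent k (fun i => (y' i : K)) ∧ IsIntegral (Algebra.adjoin k (Set.range fun i => (y' i : K))) (z' : K) ∧ IntermediateField.adjoin k (Set.range (fun i => (y' i : K)) ∪ {(z' : K)}) = ⊤ ∧ Ideal.span {f'} = RingHom.ker (MvPolynomial.aeval (Fin.snoc (fun i => (y' i : K)) (z' : K)) : MvPolynomial (Fin (n + 1)) k →ₐ[k] K) ∧ (∀ i, (y i : K) ∈ Algebra.adjoin k (Set.range (fun i => (y' i : K)) ∪ {(z' : K)})) ∧ (z : K) ∈ Algebra.adjoin k (Set.range (fun i => (y' i : K)) ∪ {(z' : K)}) ∧ axis n y' f' ≠ 0 ∧ (axis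 n y f ≠ 0 → (axis n y' f').rootMultiplicity (IsLocalRing.residue O z') ≤ (axis n y f).rootMultiplicity (IsLocalRing.residue O z)) ∧ IsSeparable (IntermediateField.adjoin k (Set.range fun i => (y' i : K))) (z' : K) ∧ ∀ (Ω : Type) [Field Ω] [Algebra K Ω] [IsAlgClosure K Ω] (V : ValuationSubring Ω), V.comap (algebraMap K Ω) = O → let F : Subfield Ω := (IntermediateField.adjoin k (Set.range fun i => (y' i : K))).toSubfield.map (algebraMap K Ω); let Fh : Subfield Ω := (IntermediateField.lift (IntermediateField.fixedField (ValuationSubring.decompositionSubgroup F (V.comap (algebraMap (separableClosure F Ω) Ω))))).toSubfield; let T : Subfield Ω := Fh ⊔ (algebraMap K Ω).fieldRange; Fh ≤ T ∧ 0 < Subfield.relfinrank Fh T ∧ Subfield.relfinrank Fh T = (Literature.AlgebraicGeometry.Resolution.valueSubgroup Fh V).relIndex (Literature.AlgebraicGeometry.Resolution.valueSubgroup T V) * (Literature.AlgebraicGeometry.Resolution.residueSubfield Fh V).relfinrank (Literature.AlgebraicGeometry.Resolution.residueSubfield T V)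

namespace Summit.ResolutionOfSingularities.ResolutionOfSingularities.Theorems

noncomputable section

namespace DefectlessFramesRefutation

/-- The ground field of the witness, `𝔽₂`. [folklore] -/
abbrev kW : Type := ZMod 2
/-- The function field of the witness, `𝔽₂(X)`. [folklore] -/
abbrev KW : Type := RatFunc (ZMod 2)

/-- The `X`-adic valuation on `𝔽₂(X)`. [folklore] -/
abbrev vX : Valuation KW (WithZero (Multiplicative ℤ)) := (Polynomial.idealX kW).valuation KW

/-- Its valuation ring `𝔽₂[X]_{(X)}`. [folklore] -/
abbrev OX : ValuationSubring KW := vX.valuationSubring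

end DefectlessFramesRefutation

open DefectlessFramesRefutation in
/-- Refutes `DefectlessFrames.DefectlessFrames` [refuted-misstated]: the hypersurface-frame
hypothesis omits `f ≠ 0` (i.e. `z` algebraic over `k(y)`); witness `k = 𝔽₂`, `K = k(X)`, `O` the
`X`-adic valuation ring (rank one, zero-dimensional), `n = 0`, `z = X`, `f = 0`: the conclusion would
produce `z' ∈ O` integral over `k` with `k(z') = K`, making `K/k` algebraic, but `X` is transcendental.
Repaired statement C′: insert the hypothesis `f ≠ 0 →` right after
`Ideal.span {f} = RingHom.ker (MvPolynomial.aeval (Fin.snoc … ) )`; this witness misses C′ (for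
`n = 0`, `f ≠ 0` forces `K/k` algebraic, and then no rank-one `O ⊇ k` exists). [folklore] -/
theorem DefectlessFramesDefectlessFrames_refuted :
    ¬ Summit.ResolutionOfSingularities.ResolutionOfSingularities.Theses.DefectlessFrames.DefectlessFrames := by
  intro h
  -- `X ∈ O`
  have X_mem_OX : (RatFunc.X : KW) ∈ OX := by
    rw [Valuation.mem_valuationSubring_iff]
    change vX RatFunc.X ≤ 1
    rw [Polynomial.valuation_X_eq_neg_one, ← WithZero.exp_zero, WithZero.exp_le_exp]
    decide
  -- constants lie in `O`
  have const_mem_OX : ∀ c : kW, algebraMap kW KW c ∈ OX := by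
    intro c
    rw [Valuation.mem_valuationSubring_iff, IsScalarTower.algebraMap_apply kW kW[X] KW]
    exact valuation_le_one _ _
  -- the valuation of `O` is equivalent to the `X`-adic valuation
  have isEquiv_OX : vX.IsEquiv OX.valuation := Valuation.isEquiv_valuation_valuationSubring _
  -- rank one
  have rankOne_OX : Nonempty OX.valuation.RankOne := by
    haveI : OX.valuation.IsNontrivial := by
      refine ⟨RatFunc.X, ?_, ?_⟩
      · simp [RatFunc.X_ne_zero]
      · intro h1
        have := (isEquiv_OX.symm.eq_one_iff_eq_one).mp h1
        simp [Polynomial.valuation_X_eq_neg_one] at this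
    rw [Valuation.nonempty_rankOne_iff_mulArchimedean]
    haveI h1 : MulArchimedean (MonoidWithZeroHom.ValueGroup₀ (.ofClass vX)) :=
      MulArchimedean.comap MonoidWithZeroHom.ValueGroup₀.embedding.toMonoidHom
        MonoidWithZeroHom.ValueGroup₀.embedding_strictMono
    exact MulArchimedean.comap (isEquiv_OX.symm.orderMonoidIso).toMonoidHom
      (isEquiv_OX.symm.orderMonoidIso).strictMono
  -- zero-dimensional: every element of `O` is congruent to a constant modulo the maximal ideal
  have zeroDim_OX : ∀ x ∈ OX, ∃ f : Polynomial kW, f ≠ 0 ∧ Polynomial.aeval x f ∈ OX.nonunits := by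
    intro x hx
    rw [Valuation.mem_valuationSubring_iff] at hx
    have hd : x.denom ≠ 0 := RatFunc.denom_ne_zero x
    have hd' : algebraMap kW[X] KW x.denom ≠ 0 := RatFunc.algebraMap_ne_zero hd
    -- the denominator is not divisible by `X`
    have hd0 : x.denom.coeff 0 ≠ 0 := by
      intro h0
      have hXd : Polynomial.X ∣ x.denom := Polynomial.X_dvd_iff.mpr h0
      have hvd : (Polynomial.idealX kW).intValuation x.denom < 1 :=
        (intValuation_lt_one_iff_mem _ _).mpr
          (by rw [Polynomial.idealX_span]; exact Ideal.mem_span_singleton.mpr hXd)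
      have hXn : ¬ Polynomial.X ∣ x.num := by
        intro hXn
        obtain ⟨a, b, hab⟩ := RatFunc.isCoprime_num_denom x
        have : Polynomial.X ∣ (1 : kW[X]) := hab ▸ dvd_add (dvd_mul_of_dvd_right hXn a)
          (dvd_mul_of_dvd_right hXd b)
        exact Polynomial.not_isUnit_X (isUnit_of_dvd_one this)
      have hvn : (Polynomial.idealX kW).intValuation x.num = 1 :=
        intValuation_eq_one_iff.mpr
          (by rw [Polynomial.idealX_span]; exact fun h => hXn (Ideal.mem_span_singleton.mp h))
      have hvx : vX x = 1 / (Polynomial.idealX kW).intValuation x.denom := by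
        conv_lhs => rw [← RatFunc.num_div_denom x]
        rw [map_div₀, valuation_of_algebraMap, valuation_of_algebraMap, hvn]
      have hpos : 0 < (Polynomial.idealX kW).intValuation x.denom :=
        zero_lt_iff.mpr (intValuation_ne_zero _ _ hd)
      have : 1 < vX x := by
        rw [hvx, one_div, one_lt_inv₀ hpos]; exact hvd
      exact absurd hx (not_le.mpr this)
    have hvd : (Polynomial.idealX kW).intValuation x.denom = 1 :=
      intValuation_eq_one_iff.mpr (by
        rw [Polynomial.idealX_span]
        exact fun h => hd0 (Polynomial.X_dvd_iff.mp (Ideal.mem_span_singleton.mp h)))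
    set c : kW := x.num.coeff 0 / x.denom.coeff 0 with hc
    refine ⟨Polynomial.X - Polynomial.C c, Polynomial.X_sub_C_ne_zero c, ?_⟩
    rw [ValuationSubring.mem_nonunits_iff, ← isEquiv_OX.lt_one_iff_lt_one]
    simp only [map_sub, Polynomial.aeval_X, Polynomial.aeval_C]
    have hx' : x - algebraMap kW KW c =
        algebraMap kW[X] KW (x.num - Polynomial.C c * x.denom) / algebraMap kW[X] KW x.denom := by
      rw [map_sub, map_mul, sub_div, mul_div_assoc, div_self hd', mul_one,
        IsScalarTower.algebraMap_apply kW kW[X] KW c, Polynomial.algebraMap_eq, RatFunc.num_div_denom]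
    rw [hx', map_div₀, valuation_of_algebraMap, valuation_of_algebraMap, hvd, div_one,
      intValuation_lt_one_iff_mem, Polynomial.idealX_span, Ideal.mem_span_singleton,
      Polynomial.X_dvd_iff]
    simp [hc, div_mul_cancel₀ _ hd0]
  -- `K = k(X)` is finitely generated
  have fg_top : (⊤ : IntermediateField kW KW).FG := ⟨{RatFunc.X}, by simp [RatFunc.adjoin_X]⟩
  -- specialise the crux to the degenerate frame `n = 0`, `z = X`, `f = 0`
  have h1 := h 2 Nat.prime_two kW KW fg_top OX const_mem_OX rankOne_OX zeroDim_OX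
  have hz : AlgebraicIndependent kW (fun i : Fin 0 => ((Fin.elim0 i : OX) : KW)) := by
    rw [algebraicIndependent_empty_type_iff]
    exact (algebraMap kW KW).injective
  have hadj : IntermediateField.adjoin kW
      (Set.range (fun i : Fin 0 => ((Fin.elim0 i : OX) : KW)) ∪ {((⟨RatFunc.X, X_mem_OX⟩ : OX) : KW)}) = ⊤ := by
    simp [Set.range_eq_empty, RatFunc.adjoin_X]
  have hker : Ideal.span {(0 : MvPolynomial (Fin (0 + 1)) kW)} =
      RingHom.ker (MvPolynomial.aeval (Fin.snoc (fun i : Fin 0 => ((Fin.elim0 i : OX) : KW))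
        ((⟨RatFunc.X, X_mem_OX⟩ : OX) : KW)) : MvPolynomial (Fin (0 + 1)) kW →ₐ[kW] KW) := by
    rw [Ideal.span_singleton_eq_bot.mpr rfl, eq_comm, ← RingHom.injective_iff_ker_eq_bot]
    haveI : Subsingleton (Fin (0 + 1)) := inferInstanceAs (Subsingleton (Fin 1))
    have hsnoc : (Fin.snoc (fun i : Fin 0 => ((Fin.elim0 i : OX) : KW))
        ((⟨RatFunc.X, X_mem_OX⟩ : OX) : KW) : Fin (0 + 1) → KW) = fun _ => (RatFunc.X : KW) := by
      funext i
      rw [Subsingleton.elim i (Fin.last 0), Fin.snoc_last]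
    have : AlgebraicIndependent kW (fun _ : Fin (0 + 1) => (RatFunc.X : KW)) := by
      rw [algebraicIndependent_singleton_iff (0 : Fin (0 + 1))]
      exact RatFunc.transcendental_X
    rw [hsnoc]
    exact this
  obtain ⟨y', z', f', -, hint, hadj', -⟩ := h1 0 Fin.elim0 ⟨RatFunc.X, X_mem_OX⟩ 0 hz hadj hker
  -- `z'` is integral over `k` (the adjoin of the empty range is `⊥`)
  have hint' : IsIntegral kW (z' : KW) := by
    haveI : Algebra.IsIntegral kW (Algebra.adjoin kW (Set.range fun i : Fin 0 => (y' i : KW))) :=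
      Algebra.IsIntegral.adjoin (by simp)
    exact isIntegral_trans (z' : KW) hint
  have hfin : FiniteDimensional kW (IntermediateField.adjoin kW {(z' : KW)}) :=
    IntermediateField.adjoin.finiteDimensional hint'
  have htop : IntermediateField.adjoin kW {(z' : KW)} = ⊤ := by
    simpa [Set.range_eq_empty] using hadj'
  have hfinK : FiniteDimensional kW KW := by
    haveI : FiniteDimensional kW (⊤ : IntermediateField kW KW) := by
      rw [← htop]; exact hfin
    exact LinearEquiv.finiteDimensional (IntermediateField.topEquiv (F := kW) (E := KW)).toLinearEquiv
  have hXint : IsIntegral kW (RatFunc.X : KW) := IsIntegral.of_finite kW _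
  exact RatFunc.transcendental_X hXint.isAlgebraic

end

end Summit.ResolutionOfSingularities.ResolutionOfSingularities.Theorems
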